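import Literature.NumberTheory.Rogawski1990.FinExplicitTransferFactorInertPlaceValuation   -- ★ B-p10 (g23): `finHeckeValue` at the one place, `(ϖ_v, θ)_v = −1`, `‖·‖_w = q_w^{log}`, `q_w = q²`
import Literature.NumberTheory.Rogawski1990.FinExplicitTransferFactorCentral                -- ★ `finHeckeValue_mul`
import Literature.NumberTheory.Rogawski1990.FinExplicitTransferFactorConjRight              -- ★ `isUnit_localRing_of_ne_zero_of_subsingleton`
import Literature.NumberTheory.Rogawski1990.RankOneUnstableNormOneSequence                  -- ★ p08 (g14): the inert toolkit (`a₀` with `σ_w a₀ − a₀ ∈ 𝒪_wˣ`)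
import Literature.NumberTheory.Automorphic.UnitaryGroupInertPlaceHyperbolicBasis            -- ★ `exists_toPlace_eq_of_galAdicCompletionMap_eq` (σ_w-fixed ⇒ from `L⁺_v`)
import Literature.NumberTheory.Automorphic.QuadraticLocalUnramifiedUnitNorm                 -- ★ `valued_eq_one_of_valued_toPlace_eq_one`
import Literature.NumberTheory.Automorphic.HeckeCharacterLocalComponentSmooth               -- ★ `HeckeCharacter.isOpen_ker_localComponent`
import HarnessLib

/-!
# [Rogawski1990 Lemma 4.9.3; LabesseLanglands1979 §2] (R1-CM), road «R1LL-tree», brick I-4b: the VALUE of the rank-one transfer factor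
# `Δ_{H∕C}(t) = μ_w(γ₁ − γ₃)⁻¹ · |γ₁ − γ₃|_w^{1∕2}` at an unramified inert place under the μ-guard: `Δ(t) = μ_w(γ₃)⁻¹ · μ_w(δ)⁻¹ · (−1)^N q^{−N}`

Topic `NumberTheory/Rogawski1990`; namespace `Literature.NumberTheory.Rogawski1990`.  THEOREMS ONLY (no definition, no instance, no notation, no named fact,
no `sorry`); Mathlib-only footing (local algebra at one place plus the norm-residue symbol of an unramified quadratic extension).
Cell `pub/hodgecm-mathlib` (D-0151), crux H413 = `stmt-HodgeConjecture-24833`, line «N6nsGerm», stub `stub_N6nsR1LL` (#159 (R1-CM), letter of record ★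
`RankOneUnstableTransferNonsplitCME`); LEAD F0P3a-plan (g10) WORD T9-8 (A) ∕ T9-10; road «R1LL-tree», architect A-p16 (g27) RULING A-1 (3) ∕ A-2 (e): brick I-4b →
F0P3a-p08 (g14); interface (I4′) with ★ `RankOneUnstableKappaTelescoping` (B-p12 (g29), I-4a).  HONEST LABEL: HC_CM is proved only modulo the printed citations (the
2 remaining named inputs hLiu418, h413) until rung 0 closes; nothing printed is asserted here.

THE MATHEMATICS.  `L` CM, `v` a finite place of `L⁺` unramified in `L` and non-split (`c • w = w`), `K = L_w`, `σ = σ_w`, `ϖ = ι_w(ϖ_v)` (a uniformiser of `K`,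
`σϖ = ϖ`), `q = #k_v` (so `#k_w = q²`), `μ` a Hecke character of `L` with print's guard `μ|_{𝕀_{L⁺}} = ω_{L∕L⁺}` (the hypothesis line of ★
`RankOneUnstableTransferNonsplitCME`).  Then (§1): `μ_w(u) = 1` for every `σ`-fixed unit `u` (it is `ι_w β` with `β ∈ 𝒪_vˣ`, and `ω_v(β) = (β, θ)_v = +1`:
units are norms at an unramified place); `μ_w(ϖ^N) = (−1)^N` (`(ϖ_v, θ)_v = −1`); `μ_w` is trivial on `1 + ϖ^{M₀}𝒪_w` for some `M₀ ≥ 1` (open kernel); and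
the CORE: for a skew unit `δ` (`σδ = −δ`) and `z ∈ K¹` (`σz·z = 1`) with `ord_w(z − 1) = N ≥ M₀`, `μ_w(z − 1) = (−1)^N · μ_w(δ)`.
PROOF OF THE CORE (Hilbert 90 made explicit; any residue characteristic, `μ_w` may be ramified): `ε := (z − 1)∕ϖ^N` is a unit with `σε = −ε∕z`; `η := ε∕δ` has
`ση = η∕z`; some `t ∈ 𝒪_w` has `t + σt = 1` (the residual Frobenius is non-trivial); `s := t + z⁻¹σt ∈ 1 + ϖ^N𝒪_w` has `σs = z s`, so `α := η s` is `σ`-FIXED of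
valuation one: `μ_w(α) = μ_w(s) = 1`, `μ_w(ε) = μ_w(δ)`, `μ_w(z − 1) = μ_w(ϖ)^N μ_w(ε) = (−1)^N μ_w(δ)` (= B-p12 (g29) census §4 ∕ A-1 (3):
«`a∕c − 1 ∈ ϖ^N·δ·(𝒪^σ)ˣ·(1 + ϖ^N𝒪)`, `μ_w(ϖ_v) = −1`, `μ_w|_{(𝒪^σ)ˣ} = 1`, `‖ϖ_v‖_w = q^{−2}`»).
§2 reads it in the letter's tokens (`E_v = UnitaryGroup.LocalRing L v`, `conjLocal`, ★ `finHeckeValue`): for norm-one `a = γ₁(t)`, `c = γ₃(t)` with `ord_w(a − c) = N ≥ M₀`,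
`μ_v(a − c)⁻¹ · (Π_{w'} ‖(a − c)_{w'}‖)^{1∕2} = μ_v(c)⁻¹ · C⁻¹ · (−1)^N q^{−N}`, `C = μ_w(δ) ≠ 0` — the transfer factor of ★ `RankOneUnstableTransferNonsplitCME` on the elliptic
torus; times ★ `neg_pow_mul_inv_pow_mul_depthValue_sub_eq` (I-4a, same `q`, `N`) it is the `N`-free closed form of `Δ·Φ^κ` for `N ≥ max(m, M₀)` (interface (I4′), I-6 A-p19).
* §1 `exists_forall_localComponent_eq_one_of_valued_sub_one_le` (`M₀`), `localComponent_eq_one_of_galAdicCompletionMap_eq` (σ-fixed units), `localComponent_toPlace_uniformizer_pow`,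
  `exists_skew_unit`, `exists_add_galAdicCompletionMap_eq_one`, CORE **`localComponent_sub_one_eq_neg_one_pow_mul`**; §2 `sqrt_prod_norm_eq_inv_pow`, HEAD
  **`exists_finHeckeValue_sub_inv_mul_sqrt_eq`**.

## References
* [Rogawski1990] J. D. Rogawski, *Automorphic Representations of Unitary Groups in Three Variables*, Ann. of Math. Stud. 123 (1990): §4.9 Lemma 4.9.3, (4.9.2)
  p. 56; §4.9 p. 55 (`μ|_{F^×} = ω_{E∕F}`, `D_H`).
* [LabesseLanglands1979] J.-P. Labesse, R. P. Langlands, *L-indistinguishability for SL(2)*, Canad. J. Math. 31 (1979): §2.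
* [Omeara1963] O. T. O'Meara, *Introduction to Quadratic Forms* (1963): §63C Example 63:16 (at an unramified place units are norms and `(ϖ, θ) = −1`).
* [Serre1979] J.-P. Serre, *Local Fields*, GTM 67 (1979): Ch. V §2 Prop. 3 (trace and norm in unramified extensions), Ch. X §1 (Hilbert 90).
* [TateThesis1967] J. Tate, *Fourier analysis in number fields and Hecke's zeta-functions*: §2.3 (quasi-characters are trivial on some `1 + 𝔭^n`).
* [NeukirchANT1999] J. Neukirch, *Algebraic Number Theory* (1999): Ch. II §6 (`‖·‖_w = (#k_w)^{−ord_w}`, `#k_w = q^{f}`).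
-/

set_option autoImplicit false

noncomputable section

open NumberField IsDedekindDomain Filter Topology ValuativeRel
open scoped ValuativeRel

namespace Literature.NumberTheory.Rogawski1990

open Literature.NumberTheory.Automorphic Literature.NumberTheory.Automorphic.UnitaryGroup Literature.NumberTheory.GaloisRepresentations
open Literature.NumberTheory.QuadraticForms Literature.NumberTheory.NumberFields
open Literature.NumberTheory.GelbartRogawski1991.UnitaryDualPair.LocalSplitting (ideleBaseChange_localUnits_of_smul_eq)

variable (L : Type) [Field L] [NumberField L] [IsCMField L] (v : HeightOneSpectrum (𝓞 ↥(maximalRealSubfield L)))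
  (w : PlacesOver L v) (hw : IsCMField.complexConj L • w.1 = w.1)

/-! ## §1 The local character `μ_w` at an unramified inert place under the guard `μ|_{𝕀_{L⁺}} = ω_{L∕L⁺}` -/

section OnePlace

omit [IsCMField L] in
/-- **`μ_w` IS TRIVIAL ON `1 + ϖ^{M₀}𝒪_w` FOR SOME `M₀ ≥ 1`** (the kernel of the continuous quasi-character `μ_w` of `L_wˣ` is open ★
`HeckeCharacter.isOpen_ker_localComponent`; the balls `|s − 1|_w ≤ |ϖ^M|_w` shrink to `1`).  No guard and no unramifiedness of `μ` is needed; `ϖ = ι_w(ϖ_v)` only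
has to be topologically nilpotent, which it is at any `w ∣ v`. [cite: TateThesis1967, §2.3] -/
theorem exists_forall_localComponent_eq_one_of_valued_sub_one_le (μ : HeckeCharacter L) :
    ∃ M₀ : ℕ, 1 ≤ M₀ ∧ ∀ (s : w.1.adicCompletion L) (hs : s ≠ 0),
      Valued.v (s - 1) ≤ Valued.v ((toPlace v w (HeckeCharacter.uniformizer ↥(maximalRealSubfield L) v : v.adicCompletion ↥(maximalRealSubfield L))) ^ M₀) →
      μ.localComponent w.1 (Units.mk0 s hs) = 1 := by
  set ϖ : w.1.adicCompletion L := toPlace v w (HeckeCharacter.uniformizer ↥(maximalRealSubfield L) v : v.adicCompletion ↥(maximalRealSubfield L)) with hϖdef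
  have hϖ1 : Valued.v ϖ < 1 := by
    haveI := PlacesOver.liesOver w
    rw [hϖdef, valued_toPlace, HeckeCharacter.valued_uniformizer]
    exact pow_lt_one₀ zero_le (by rw [← WithZero.exp_zero]; exact WithZero.exp_lt_exp.2 (by norm_num))
      (Ideal.IsDedekindDomain.ramificationIdx'_ne_zero_of_liesOver w.1.asIdeal v.ne_bot)
  by_contra hcon
  push Not at hcon
  -- a bad sequence `s_M → 1` with `μ_w(s_M) ≠ 1`
  have hch : ∀ M : ℕ, ∃ (s : w.1.adicCompletion L) (hs : s ≠ 0), Valued.v (s - 1) ≤ Valued.v (ϖ ^ (M + 1)) ∧ μ.localComponent w.1 (Units.mk0 s hs) ≠ 1 :=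
    fun M => hcon (M + 1) (by omega)
  choose s hs hsv hsne using hch
  have hpow : Tendsto (fun M : ℕ => ϖ ^ (M + 1)) atTop (𝓝 0) :=
    (Valued.tendsto_zero_pow_of_v_lt_one hϖ1).comp (tendsto_add_atTop_nat 1)
  have hnorm : Tendsto (fun M : ℕ => ‖ϖ ^ (M + 1)‖) atTop (𝓝 0) := by
    simpa only [Function.comp_def, norm_zero] using (continuous_norm.tendsto (0 : w.1.adicCompletion L)).comp hpow
  have hsub : Tendsto (fun M : ℕ => ‖s M - 1‖) atTop (𝓝 0) :=
    squeeze_zero (fun M => norm_nonneg _) (fun M => Valued.toNormedField.norm_le_iff.2 (hsv M)) hnorm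
  have hs1 : Tendsto s atTop (𝓝 1) := tendsto_iff_norm_sub_tendsto_zero.2 hsub
  have hu1 : Tendsto (fun M : ℕ => Units.mk0 (s M) (hs M)) atTop (𝓝 1) := by
    rw [Units.isEmbedding_val₀.tendsto_nhds_iff]
    simpa only [Function.comp_def, Units.val_mk0, Units.val_one] using hs1
  have hker : ((μ.localComponent w.1).ker : Set (w.1.adicCompletion L)ˣ) ∈ 𝓝 (1 : (w.1.adicCompletion L)ˣ) :=
    (μ.isOpen_ker_localComponent w.1).mem_nhds (one_mem _)
  obtain ⟨M, hM⟩ := (hu1.eventually_mem hker).exists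
  exact hsne M (by simpa only [SetLike.mem_coe, MonoidHom.mem_ker] using hM)

variable (hunr : Algebra.IsUnramifiedIn (𝓞 L) v.asIdeal) (μ : HeckeCharacter L)
  (hμω : ∀ x : ideleGroup ↥(maximalRealSubfield L), μ (AdeleRing.ideleBaseChange ↥(maximalRealSubfield L) L x) = quadraticHeckeCharCM L x)

include hw hunr hμω in
/-- **`μ_w(ι_w β) = 1` for `β ∈ 𝒪_vˣ`** under the guard at a non-split `v` unramified in `L`: `μ_w(ι_w β) = μ(⟨β⟩_v ⊗ 1) = ω(⟨β⟩_v) = (β, θ)_v = +1` — units are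
norms at an unramified place (O'Meara 63:16, ★ `hilbertSymbol_eq_one_of_valued_eq_one_of_isUnramifiedIn`). [cite: Omeara1963, §63C Example 63:16]
[cite: Rogawski1990, §4.9 p. 55] -/
theorem localComponent_map_toPlace_eq_one_of_valued_eq_one (β : (v.adicCompletion ↥(maximalRealSubfield L))ˣ)
    (hβ : Valued.v (β : v.adicCompletion ↥(maximalRealSubfield L)) = 1) :
    μ.localComponent w.1 (Units.map (toPlace v w : v.adicCompletion ↥(maximalRealSubfield L) →* w.1.adicCompletion L) β) = 1 := by
  haveI : Algebra.IsQuadraticExtension ↥(maximalRealSubfield L) L := IsCMField.isQuadraticExtension L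
  obtain ⟨α, hα0, hcα, hsq⟩ := cmQuadraticGenerator_spec L
  apply Units.val_eq_one.1
  rw [HeckeCharacter.localComponent_apply, ← ideleBaseChange_localUnits_of_smul_eq L v w hw β, hμω, quadraticHeckeCharCM_def,
    quadraticHeckeChar_localUnits (not_isSquare_cmQuadraticGenerator L) v β,
    hilbertSymbol_eq_one_of_valued_eq_one_of_isUnramifiedIn ↥(maximalRealSubfield L) v hsq (algebraMap_ne_of_complexConj_eq_neg hcα hα0) hunr hβ,
    Int.cast_one]

include hw hunr hμω in
/-- **`μ_w(u) = 1` FOR EVERY `σ_w`-FIXED UNIT `u` OF `L_w`** (guard, `v` non-split and unramified in `L`): a `σ_w`-fixed element is `ι_w β` (★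
`exists_toPlace_eq_of_galAdicCompletionMap_eq`), `|β|_v = 1` (★ `valued_eq_one_of_valued_toPlace_eq_one`), and `μ_w(ι_w β) = (β, θ)_v = 1`.  Print: «`μ|_{F^×} = ω_{E∕F}`»,
`ω` trivial on `𝒪_F^×` at an unramified place. [cite: Rogawski1990, §4.9 p. 55] [cite: Omeara1963, §63C Example 63:16] -/
theorem localComponent_eq_one_of_galAdicCompletionMap_eq (u : (w.1.adicCompletion L)ˣ)
    (hσu : galAdicCompletionMap (L := L) (IsCMField.complexConj L) hw (u : w.1.adicCompletion L) = u) (hu : Valued.v (u : w.1.adicCompletion L) = 1) :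
    μ.localComponent w.1 u = 1 := by
  haveI : Algebra.IsQuadraticExtension ↥(maximalRealSubfield L) L := IsCMField.isQuadraticExtension L
  obtain ⟨p, hp⟩ := exists_toPlace_eq_of_galAdicCompletionMap_eq (IsCMField.complexConj L) w (IsCMField.complexConj_ne_one L) hw (u : w.1.adicCompletion L) hσu
  have hp1 : Valued.v p = 1 := valued_eq_one_of_valued_toPlace_eq_one L v w (by rw [hp]; exact hu)
  have hp0 : p ≠ 0 := fun h0 => by rw [h0, map_zero] at hp1; exact zero_ne_one hp1
  have hu' : u = Units.map (toPlace v w : v.adicCompletion ↥(maximalRealSubfield L) →* w.1.adicCompletion L) (Units.mk0 p hp0) :=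
    Units.ext (by rw [Units.coe_map, MonoidHom.coe_coe, Units.val_mk0, hp])
  rw [hu']
  exact localComponent_map_toPlace_eq_one_of_valued_eq_one L v w hw hunr μ hμω (Units.mk0 p hp0) hp1

include hw hunr hμω in
/-- **`μ_w(ϖ^N) = (−1)^N`** for `ϖ = ι_w(ϖ_v)` (guard, `v` non-split unramified in `L`): `μ_w(ι_w ϖ_v) = ω(⟨ϖ_v⟩_v) = (ϖ_v, θ)_v = −1` (`θ` a non-square at the
non-split `v`, `ord_v ϖ_v` odd — O'Meara 63:16; the step of ★ `localComponent_eq_neg_one_zpow_of_nonsplit_of_isUnramifiedIn` that does not use «`μ` unramified»).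
[cite: Rogawski1990, §4.9 p. 55] [cite: Omeara1963, §63C Example 63:16] -/
theorem localComponent_toPlace_uniformizer_pow {π : w.1.adicCompletion L}
    (hπ : π = toPlace v w (HeckeCharacter.uniformizer ↥(maximalRealSubfield L) v : v.adicCompletion ↥(maximalRealSubfield L))) (N : ℕ) (h0 : π ^ N ≠ 0) :
    ((μ.localComponent w.1 (Units.mk0 (π ^ N) h0) : ℂˣ) : ℂ) = (-1 : ℂ) ^ N := by
  haveI : Algebra.IsQuadraticExtension ↥(maximalRealSubfield L) L := IsCMField.isQuadraticExtension L
  obtain ⟨α, hα0, hcα, hsq⟩ := cmQuadraticGenerator_spec L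
  have hθ : α * α = algebraMap ↥(maximalRealSubfield L) L (cmQuadraticGenerator L : ↥(maximalRealSubfield L)) := by rw [← sq]; exact hsq
  set ϖ : (v.adicCompletion ↥(maximalRealSubfield L))ˣ := HeckeCharacter.uniformizer ↥(maximalRealSubfield L) v with hϖdef
  have hodd : Odd (WithZero.log (Valued.v (ϖ : v.adicCompletion ↥(maximalRealSubfield L)))) := by
    rw [hϖdef, HeckeCharacter.valued_uniformizer, WithZero.log_exp]
    exact ⟨-1, by norm_num⟩
  have hval : ((μ.localComponent w.1 (Units.map (toPlace v w : v.adicCompletion ↥(maximalRealSubfield L) →* w.1.adicCompletion L) ϖ) : ℂˣ) : ℂ) = -1 := by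
    rw [HeckeCharacter.localComponent_apply, ← ideleBaseChange_localUnits_of_smul_eq L v w hw ϖ, hμω, quadraticHeckeCharCM_def,
      quadraticHeckeChar_localUnits (not_isSquare_cmQuadraticGenerator L) v ϖ,
      hilbertSymbol_eq_neg_one_of_odd_of_isUnramifiedIn ↥(maximalRealSubfield L) v hsq (algebraMap_ne_of_complexConj_eq_neg hcα hα0) hunr
        (Liu2021.LemD1IndexedNonVacuityNonsplitPlace.not_isSquare_delta_sq_of_nonsplit L v (IsCMField.complexConj L) hcα hα0 w hw hθ) ϖ.ne_zero hodd,
      Int.cast_neg, Int.cast_one]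
  have hunit : Units.mk0 (π ^ N) h0 = (Units.map (toPlace v w : v.adicCompletion ↥(maximalRealSubfield L) →* w.1.adicCompletion L) ϖ) ^ N :=
    Units.ext (by rw [Units.val_mk0, Units.val_pow_eq_pow_val, Units.coe_map, MonoidHom.coe_coe, hϖdef, hπ])
  rw [hunit, map_pow, Units.val_pow_eq_pow_val, hval]

include hw hunr in
/-- **An `a₀ ∈ 𝒪_w` moved by `σ_w` by a UNIT** at an unramified inert place (the residual Frobenius of `k_w ∕ k_v` is non-trivial, ★
`exists_isUnit_map_sub_of_residueHom_ne`); dyadic places included. [cite: Serre1979, Ch. V §2 Prop. 3] -/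
theorem exists_valued_galAdicCompletionMap_sub_eq_one :
    ∃ a₀ : w.1.adicCompletion L, Valued.v a₀ ≤ 1 ∧ Valued.v (galAdicCompletionMap (L := L) (IsCMField.complexConj L) hw a₀ - a₀) = 1 := by
  classical
  have hc1 : IsCMField.complexConj L ≠ 1 := IsCMField.complexConj_ne_one L
  set σ := galAdicCompletionMap (L := L) (IsCMField.complexConj L) hw with hσdef
  have hσO : ∀ x : 𝒪[w.1.adicCompletion L], σ x ∈ 𝒪[w.1.adicCompletion L] := mem_integer_galAdicCompletionMap (IsCMField.complexConj L) v w hw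
  obtain ⟨σk, hσk⟩ := exists_residueField_ringHom_galAdicCompletionMap (IsCMField.complexConj L) v w hw
  have hq : Nat.card 𝓀[w.1.adicCompletion L] = Nat.card (𝓞 ↥(maximalRealSubfield L) ⧸ v.asIdeal) ^ 2 :=
    natCard_residueField_eq_sq_of_inert (IsCMField.complexConj L) v hc1 hunr w hw
  letI : Fintype 𝓀[w.1.adicCompletion L] := Fintype.ofFinite _
  have hq' : Fintype.card 𝓀[w.1.adicCompletion L] = Nat.card (𝓞 ↥(maximalRealSubfield L) ⧸ v.asIdeal) ^ 2 := by rw [← Nat.card_eq_fintype_card, hq]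
  obtain ⟨a₀, ha₀⟩ := LocalFields.UnramifiedQuadraticNorm.exists_isUnit_map_sub_of_residueHom_ne σ hσO σk hσk
    (Literature.LinearAlgebra.Matrix.exists_frob_ne hq' σk (residueHom_galAdicCompletionMap_eq_pow (IsCMField.complexConj L) v hc1 hunr w hw σk hσO hσk))
  refine ⟨a₀, (v_le_one_iff_mem_integer _).2 a₀.2, ?_⟩
  have h := (Valuation.integer.integers (valuation (w.1.adicCompletion L))).isUnit_iff_valuation_eq_one.1 ha₀
  exact (v_eq_one_iff_valuation_eq_one _).2 h

include hw hunr in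
/-- **A SKEW UNIT EXISTS at an unramified inert place**: some `δ ∈ L_w` has `σ_w δ = −δ` and `|δ|_w = 1` (`δ = σ_w a₀ − a₀`). [cite: Serre1979, Ch. V §2 Prop. 3] -/
theorem exists_skew_unit :
    ∃ δ : w.1.adicCompletion L, galAdicCompletionMap (L := L) (IsCMField.complexConj L) hw δ = -δ ∧ Valued.v δ = 1 := by
  obtain ⟨a₀, -, hda⟩ := exists_valued_galAdicCompletionMap_sub_eq_one L v w hw hunr
  refine ⟨_, ?_, hda⟩
  rw [map_sub, galAdicCompletionMap_galAdicCompletionMap_of_smul_eq (IsCMField.complexConj L) w (IsCMField.complexConj_ne_one L) hw, neg_sub]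

include hw hunr in
/-- **THE TRACE `𝒪_w → 𝒪_v` HITS `1`**: some `t ∈ L_w` with `|t|_w ≤ 1` has `t + σ_w t = 1` — `t = −a₀ ∕ (σ_w a₀ − a₀)`. [cite: Serre1979, Ch. V §2 Prop. 3] -/
theorem exists_add_galAdicCompletionMap_eq_one :
    ∃ t : w.1.adicCompletion L, Valued.v t ≤ 1 ∧ t + galAdicCompletionMap (L := L) (IsCMField.complexConj L) hw t = 1 := by
  set σ := galAdicCompletionMap (L := L) (IsCMField.complexConj L) hw with hσdef
  have hσσ : ∀ x, σ (σ x) = x := fun x =>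
    galAdicCompletionMap_galAdicCompletionMap_of_smul_eq (IsCMField.complexConj L) w (IsCMField.complexConj_ne_one L) hw x
  obtain ⟨a₀, ha₀v, hda⟩ := exists_valued_galAdicCompletionMap_sub_eq_one L v w hw hunr
  have hd0 : σ a₀ - a₀ ≠ 0 := fun h0 => by rw [h0, map_zero] at hda; exact zero_ne_one hda
  refine ⟨-a₀ / (σ a₀ - a₀), ?_, ?_⟩
  · rw [Valuation.map_div, Valuation.map_neg, hda, div_one]; exact ha₀v
  · rw [map_div₀, map_neg, map_sub, hσσ]
    have h2 : a₀ - σ a₀ = -(σ a₀ - a₀) := by ring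
    rw [h2, div_neg, neg_div, neg_div, neg_neg, ← neg_div, ← add_div, div_eq_one_iff_eq hd0, neg_add_eq_sub]

include hw hunr hμω in
/-- **THE CORE: `μ_w(z − 1) = (−1)^N · μ_w(δ)`** for a skew unit `δ` (`σ_w δ = −δ`, `|δ|_w = 1`) and a norm-one `z` (`σ_w z · z = 1`) with `|z − 1|_w = |ϖ^N|_w`,
`N ≥ M₀` where `μ_w ≡ 1` on `{s : |s − 1|_w ≤ |ϖ^{M₀}|_w}` (hypothesis `hM₀`, supplied by `exists_forall_localComponent_eq_one_of_valued_sub_one_le`).  Hilbert 90 made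
explicit: `ε = (z−1)∕ϖ^N`, `σε = −ε∕z`; `η = ε∕δ`, `ση = η∕z`; `t + σt = 1` (`exists_add_galAdicCompletionMap_eq_one`), `s = t + z⁻¹σt ∈ 1 + ϖ^N𝒪_w`, `σs = z s`;
`α = η s` is `σ`-fixed of valuation one, so `μ_w(α) = μ_w(s) = 1`, `μ_w(ε) = μ_w(δ)`, and `μ_w(ϖ^N) = (−1)^N`.  Print: «`Δ_H = μ⁻¹(γ₁ − γ₃) D_H`», `μ|_{F^×} = ω_{E∕F}`;
[LL] §2: `Δ·Φ^κ` extends across the singular sub-torus. [cite: Rogawski1990, §4.9 Lemma 4.9.3 (4.9.2) p. 56; §4.9 p. 55] [cite: LabesseLanglands1979, §2]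
[cite: Serre1979, Ch. X §1; Ch. V §2 Prop. 3] -/
theorem localComponent_sub_one_eq_neg_one_pow_mul {δ : w.1.adicCompletion L}
    (hσδ : galAdicCompletionMap (L := L) (IsCMField.complexConj L) hw δ = -δ) (hδ : Valued.v δ = 1) (hδ0 : δ ≠ 0)
    {M₀ : ℕ} (hM₁ : 1 ≤ M₀) (hM₀ : ∀ (s : w.1.adicCompletion L) (hs : s ≠ 0),
      Valued.v (s - 1) ≤ Valued.v ((toPlace v w (HeckeCharacter.uniformizer ↥(maximalRealSubfield L) v : v.adicCompletion ↥(maximalRealSubfield L))) ^ M₀) →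
      μ.localComponent w.1 (Units.mk0 s hs) = 1)
    {z : w.1.adicCompletion L} {N : ℕ} (hMN : M₀ ≤ N) (hz : galAdicCompletionMap (L := L) (IsCMField.complexConj L) hw z * z = 1)
    (hN : Valued.v (z - 1) = Valued.v ((toPlace v w (HeckeCharacter.uniformizer ↥(maximalRealSubfield L) v : v.adicCompletion ↥(maximalRealSubfield L))) ^ N))
    (hz1 : z - 1 ≠ 0) :
    ((μ.localComponent w.1 (Units.mk0 (z - 1) hz1) : ℂˣ) : ℂ) = (-1 : ℂ) ^ N * ((μ.localComponent w.1 (Units.mk0 δ hδ0) : ℂˣ) : ℂ) := by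
  classical
  have hc1 : IsCMField.complexConj L ≠ 1 := IsCMField.complexConj_ne_one L
  set σ := galAdicCompletionMap (L := L) (IsCMField.complexConj L) hw with hσdef
  set ϖ : w.1.adicCompletion L := toPlace v w (HeckeCharacter.uniformizer ↥(maximalRealSubfield L) v : v.adicCompletion ↥(maximalRealSubfield L)) with hϖdef
  have hσσ : ∀ x, σ (σ x) = x := fun x => galAdicCompletionMap_galAdicCompletionMap_of_smul_eq (IsCMField.complexConj L) w hc1 hw x
  have hσv : ∀ x, Valued.v (σ x) = Valued.v x := fun x => valued_galAdicCompletionMap (L := L) (IsCMField.complexConj L) hw x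
  have hϖv : Valued.v ϖ = WithZero.exp (-1 : ℤ) := Liu2021.LemD1IndexedNonVacuityInertCofinite.valued_toPlace_uniformizer_of_isUnramifiedIn L v hunr w
  have hϖ1 : Valued.v ϖ < 1 := by rw [hϖv, ← WithZero.exp_zero]; exact WithZero.exp_lt_exp.2 (by norm_num)
  have hϖ0 : ϖ ≠ 0 := fun h0 => by rw [h0, map_zero] at hϖv; exact WithZero.zero_ne_coe hϖv
  have hϖN0 : ϖ ^ N ≠ 0 := pow_ne_zero _ hϖ0
  have hσϖ : σ ϖ = ϖ := galAdicCompletionMap_toPlace (IsCMField.complexConj L) w w hw _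
  -- `z` is a unit with `σ z = z⁻¹`
  have hvz1 : Valued.v (z - 1) < 1 := by
    rw [hN, Valuation.map_pow]; exact pow_lt_one₀ zero_le hϖ1 (by omega)
  have hvz : Valued.v z = 1 := by
    have h := Valuation.map_one_add_of_lt (Valued.v : Valuation (w.1.adicCompletion L) _) hvz1
    rwa [add_sub_cancel] at h
  have hz0 : z ≠ 0 := fun h0 => by rw [h0, map_zero] at hvz; exact zero_ne_one hvz
  have hσz : σ z = z⁻¹ := eq_inv_of_mul_eq_one_left hz
  -- `ε := (z - 1) / ϖ^N`, a unit with `σ ε = -ε / z`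
  set ε : w.1.adicCompletion L := (z - 1) / ϖ ^ N with hεdef
  have hεv : Valued.v ε = 1 := by rw [hεdef, Valuation.map_div, hN, div_self ((Valuation.ne_zero_iff _).2 hϖN0)]
  have hε0 : ε ≠ 0 := fun h0 => by rw [h0, map_zero] at hεv; exact zero_ne_one hεv
  have hσε : σ ε = -ε / z := by
    rw [hεdef, map_div₀, map_sub, map_one, map_pow, hσϖ, hσz]
    field_simp
    ring
  -- `η := ε / δ`, with `σ η = η / z`
  set η : w.1.adicCompletion L := ε / δ with hηdef
  have hηv : Valued.v η = 1 := by rw [hηdef, Valuation.map_div, hεv, hδ, div_one]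
  have hη0 : η ≠ 0 := fun h0 => by rw [h0, map_zero] at hηv; exact zero_ne_one hηv
  have hση : σ η = η / z := by
    rw [hηdef, map_div₀, hσε, hσδ]
    field_simp
  -- the trace-one element `t` and `s := t + z⁻¹ σ t = 1 + (z⁻¹ - 1) σ t ∈ 1 + ϖ^N 𝒪_w`
  obtain ⟨t, htv, ht⟩ := exists_add_galAdicCompletionMap_eq_one L v w hw hunr
  set s : w.1.adicCompletion L := t + z⁻¹ * σ t with hsdef
  have hs1 : s - 1 = (z⁻¹ - 1) * σ t := by
    rw [hsdef]
    linear_combination ht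
  have hzinv : Valued.v (z⁻¹ - 1) = Valued.v (z - 1) := by
    have h : z⁻¹ - 1 = -(z - 1) / z := by field_simp; ring
    rw [h, Valuation.map_div, Valuation.map_neg, hvz, div_one]
  have hsv1 : Valued.v (s - 1) ≤ Valued.v (ϖ ^ M₀) := by
    rw [hs1, Valuation.map_mul, hzinv, hN, hσv, Valuation.map_pow, Valuation.map_pow]
    calc Valued.v ϖ ^ N * Valued.v t ≤ Valued.v ϖ ^ N * 1 := by gcongr
      _ = Valued.v ϖ ^ N := mul_one _
      _ ≤ Valued.v ϖ ^ M₀ := pow_le_pow_right_of_le_one' hϖ1.le hMN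
  have hϖM1 : Valued.v (ϖ ^ M₀) < 1 := by rw [Valuation.map_pow]; exact pow_lt_one₀ zero_le hϖ1 (by omega)
  have hsvlt : Valued.v (s - 1) < 1 := lt_of_le_of_lt hsv1 hϖM1
  have hvs : Valued.v s = 1 := by
    have h := Valuation.map_one_add_of_lt (Valued.v : Valuation (w.1.adicCompletion L) _) hsvlt
    rwa [add_sub_cancel] at h
  have hs0 : s ≠ 0 := fun h0 => by rw [h0, map_zero] at hvs; exact zero_ne_one hvs
  have hμs : μ.localComponent w.1 (Units.mk0 s hs0) = 1 := hM₀ s hs0 hsv1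
  have hσs : σ s = z * s := by
    rw [hsdef, map_add, map_mul, map_inv₀, hσσ, hσz, inv_inv]
    field_simp
    ring
  -- `α := η * s` is `σ`-fixed of valuation one, so `μ_w(α) = 1`
  have hα0 : η * s ≠ 0 := mul_ne_zero hη0 hs0
  have hσα : σ (η * s) = η * s := by
    rw [map_mul, hση, hσs]
    field_simp
  have hαv : Valued.v (η * s) = 1 := by rw [Valuation.map_mul, hηv, hvs, one_mul]
  have hμα : μ.localComponent w.1 (Units.mk0 (η * s) hα0) = 1 :=
    localComponent_eq_one_of_galAdicCompletionMap_eq L v w hw hunr μ hμω (Units.mk0 (η * s) hα0) hσα hαv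
  have hμη : μ.localComponent w.1 (Units.mk0 η hη0) = 1 := by
    have h : Units.mk0 (η * s) hα0 = Units.mk0 η hη0 * Units.mk0 s hs0 := Units.ext rfl
    rw [h, map_mul, hμs, mul_one] at hμα
    exact hμα
  have hεδ : Units.mk0 ε hε0 = Units.mk0 η hη0 * Units.mk0 δ hδ0 :=
    Units.ext (by rw [Units.val_mul, Units.val_mk0, Units.val_mk0, Units.val_mk0, hηdef, div_mul_cancel₀ _ hδ0])
  have hμε : μ.localComponent w.1 (Units.mk0 ε hε0) = μ.localComponent w.1 (Units.mk0 δ hδ0) := by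
    rw [hεδ, map_mul, hμη, one_mul]
  have hzε : Units.mk0 (z - 1) hz1 = Units.mk0 (ϖ ^ N) hϖN0 * Units.mk0 ε hε0 :=
    Units.ext (by rw [Units.val_mul, Units.val_mk0, Units.val_mk0, Units.val_mk0, hεdef, mul_div_cancel₀ _ hϖN0])
  rw [hzε, map_mul, Units.val_mul, localComponent_toPlace_uniformizer_pow L v w hw hunr μ hμω hϖdef N hϖN0, hμε]

end OnePlace

/-! ## §2 The transfer factor of ★ `RankOneUnstableTransferNonsplitCME` in the letter's tokens (`E_v = LocalRing L v`, `conjLocal`, ★ `finHeckeValue`) -/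

section Letter

variable (hunr : Algebra.IsUnramifiedIn (𝓞 L) v.asIdeal)

include hw hunr in
/-- **`(Π_{w'} ‖x_{w'}‖_{w'})^{1∕2} = q^{−N}`** for `x ∈ E_v` with `|x_w|_w = |ϖ^N|_w` at a non-split `v` unramified in `L` (`q = #k_v`; the product has the single factor
`w`, `‖·‖_w = (#k_w)^{−ord_w}`, `#k_w = q²` ★ `absNorm_placesOver_eq_sq_of_nonsplit_of_isUnramifiedIn`) — print's `D_H = |γ₁ − γ₃|_E^{1∕2} = q^{−N}`.
[cite: Rogawski1990, §4.9 p. 55; §4.3 (4.3.1) p. 43] [cite: NeukirchANT1999, Ch. II §6] -/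
theorem sqrt_prod_norm_eq_inv_pow {x : LocalRing L v} {N : ℕ}
    (hx : Valued.v (x w) = Valued.v ((toPlace v w (HeckeCharacter.uniformizer ↥(maximalRealSubfield L) v : v.adicCompletion ↥(maximalRealSubfield L))) ^ N)) :
    Real.sqrt (∏ w' : PlacesOver L v, ‖x w'‖) = (((Nat.card (𝓞 ↥(maximalRealSubfield L) ⧸ v.asIdeal) : ℝ) ^ N))⁻¹ := by
  haveI : Algebra.IsQuadraticExtension ↥(maximalRealSubfield L) L := IsCMField.isQuadraticExtension L
  haveI hv : Subsingleton (PlacesOver L v) :=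
    PlacesOver.subsingleton_of_smul_eq (IsCMField.complexConj L) (IsCMField.complexConj_ne_one L) w hw
  set ϖ : w.1.adicCompletion L := toPlace v w (HeckeCharacter.uniformizer ↥(maximalRealSubfield L) v : v.adicCompletion ↥(maximalRealSubfield L)) with hϖdef
  have hϖv : Valued.v ϖ = WithZero.exp (-1 : ℤ) := Liu2021.LemD1IndexedNonVacuityInertCofinite.valued_toPlace_uniformizer_of_isUnramifiedIn L v hunr w
  have hϖ0 : ϖ ≠ 0 := fun h0 => by rw [h0, map_zero] at hϖv; exact WithZero.zero_ne_coe hϖv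
  have hz : x w ≠ 0 := fun h0 => by
    rw [h0, map_zero] at hx
    exact (Valuation.ne_zero_iff _).2 (pow_ne_zero N hϖ0) hx.symm
  have hq : Ideal.absNorm v.asIdeal = Nat.card (𝓞 ↥(maximalRealSubfield L) ⧸ v.asIdeal) := by
    rw [Ideal.absNorm_apply, Submodule.cardQuot_apply]
  rw [Fintype.prod_subsingleton _ w, norm_eq_absNorm_zpow_log L hz, hx, Valuation.map_pow, hϖv, ← WithZero.exp_nsmul, WithZero.log_exp,
    absNorm_placesOver_eq_sq_of_nonsplit_of_isUnramifiedIn L v w hw hunr, hq]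
  have h2 : (((Nat.card (𝓞 ↥(maximalRealSubfield L) ⧸ v.asIdeal)) ^ 2 : ℕ) : ℝ) ^ (N • (-1 : ℤ)) =
      ((((Nat.card (𝓞 ↥(maximalRealSubfield L) ⧸ v.asIdeal)) : ℝ) ^ N)⁻¹) ^ 2 := by
    rw [nsmul_eq_mul, mul_neg, mul_one, zpow_neg, zpow_natCast, Nat.cast_pow, ← pow_mul, mul_comm, pow_mul, inv_pow]
  rw [h2, Real.sqrt_sq (by positivity)]

variable (μ : HeckeCharacter L)
  (hμω : ∀ x : ideleGroup ↥(maximalRealSubfield L), μ (AdeleRing.ideleBaseChange ↥(maximalRealSubfield L) L x) = quadraticHeckeCharCM L x)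

include hw hunr hμω in
/-- **HEAD — THE VALUE OF THE RANK-ONE TRANSFER FACTOR NEAR THE SINGULAR SUB-TORUS.**  At a non-split place `v` unramified in the CM field `L` (`w ∣ v`), for `μ`
with print's guard `μ|_{𝕀_{L⁺}} = ω_{L∕L⁺}` (★ `RankOneUnstableTransferNonsplitCME`'s hypothesis line) there are a level `M₀` and a constant `C ≠ 0` (`C = μ_w(δ)` for
a skew unit `δ`) such that for all norm-one `a, c ∈ E_v` (`σa·a = σc·c = 1`; the eigenvalues `γ₁(t), γ₃(t)` of the `U(Φ₂)`-part of `t ∈ C`) with `|a − c|_w = |ϖ_v|_w^N`,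
`N ≥ M₀`:  `μ_v(a − c)⁻¹ · (Π_{w'}‖(a − c)_{w'}‖)^{1∕2} = μ_v(c)⁻¹ · C⁻¹ · (−1)^N · q^{−N}` (`q = #k_v`) — the factor `Δ_{H∕C}(t) = μ⁻¹(γ₁ − γ₃) D_H` of (4.9.2)
read through ★ `finHeckeValue`; with ★ `neg_pow_mul_inv_pow_mul_depthValue_sub_eq` (same `q`, `N`) the product `Δ·Φ^κ` is `N`-free for `N ≥ max(m, M₀)`.
[cite: Rogawski1990, §4.9 Lemma 4.9.3 (4.9.2) p. 56; §4.9 p. 55; §4.3 (4.3.1) p. 43] [cite: LabesseLanglands1979, §2] -/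
theorem exists_finHeckeValue_sub_inv_mul_sqrt_eq :
    ∃ (M₀ : ℕ) (C : ℂ), C ≠ 0 ∧ ∀ (a c : LocalRing L v) (N : ℕ), M₀ ≤ N →
      conjLocal L (IsCMField.complexConj L) v a * a = 1 → conjLocal L (IsCMField.complexConj L) v c * c = 1 →
      Valued.v (a w - c w) = Valued.v ((toPlace v w (HeckeCharacter.uniformizer ↥(maximalRealSubfield L) v : v.adicCompletion ↥(maximalRealSubfield L))) ^ N) →
      (finHeckeValue L v μ (a - c))⁻¹ * ((Real.sqrt (∏ w' : PlacesOver L v, ‖(a - c) w'‖) : ℝ) : ℂ) =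
        (finHeckeValue L v μ c)⁻¹ * C⁻¹ * ((-1 : ℂ) ^ N * (((Nat.card (𝓞 ↥(maximalRealSubfield L) ⧸ v.asIdeal) : ℂ) ^ N))⁻¹) := by
  classical
  haveI : Algebra.IsQuadraticExtension ↥(maximalRealSubfield L) L := IsCMField.isQuadraticExtension L
  have hc1 : IsCMField.complexConj L ≠ 1 := IsCMField.complexConj_ne_one L
  haveI hv : Subsingleton (PlacesOver L v) := PlacesOver.subsingleton_of_smul_eq (IsCMField.complexConj L) hc1 w hw
  obtain ⟨M₀, hM₁, hM₀⟩ := exists_forall_localComponent_eq_one_of_valued_sub_one_le L v w μ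
  obtain ⟨δ, hσδ, hδ⟩ := exists_skew_unit L v w hw hunr
  have hδ0 : δ ≠ 0 := fun h0 => by rw [h0, map_zero] at hδ; exact zero_ne_one hδ
  refine ⟨M₀, ((μ.localComponent w.1 (Units.mk0 δ hδ0) : ℂˣ) : ℂ), Units.ne_zero _, fun a c N hMN ha hc hN => ?_⟩
  set σ := galAdicCompletionMap (L := L) (IsCMField.complexConj L) hw with hσdef
  set ϖ : w.1.adicCompletion L := toPlace v w (HeckeCharacter.uniformizer ↥(maximalRealSubfield L) v : v.adicCompletion ↥(maximalRealSubfield L)) with hϖdef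
  have hϖv : Valued.v ϖ = WithZero.exp (-1 : ℤ) := Liu2021.LemD1IndexedNonVacuityInertCofinite.valued_toPlace_uniformizer_of_isUnramifiedIn L v hunr w
  have hϖ0 : ϖ ≠ 0 := fun h0 => by rw [h0, map_zero] at hϖv; exact WithZero.zero_ne_coe hϖv
  have hϖN0 : ϖ ^ N ≠ 0 := pow_ne_zero _ hϖ0
  have haw : σ (a w) * a w = 1 := by
    have h := congrArg (fun y : LocalRing L v => y w) ha
    simpa only [Pi.mul_apply, Pi.one_apply, conjLocal_apply_eq_galAdicCompletionMap L v w hw] using h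
  have hcw : σ (c w) * c w = 1 := by
    have h := congrArg (fun y : LocalRing L v => y w) hc
    simpa only [Pi.mul_apply, Pi.one_apply, conjLocal_apply_eq_galAdicCompletionMap L v w hw] using h
  have hvc : Valued.v (c w) = 1 := valued_apply_eq_one_of_conjLocal_mul_self L v w hw hc
  have hc0 : c w ≠ 0 := fun h0 => by rw [h0, map_zero] at hvc; exact zero_ne_one hvc
  have hac0 : a w - c w ≠ 0 := fun h0 => by
    rw [h0, map_zero] at hN
    exact (Valuation.ne_zero_iff _).2 hϖN0 hN.symm
  -- `z := a_w / c_w` is norm-one with `z - 1 = (a_w - c_w) / c_w`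
  set z : w.1.adicCompletion L := a w / c w with hzdef
  have hz : σ z * z = 1 := by
    rw [hzdef, map_div₀, div_mul_div_comm, haw, hcw, div_one]
  have hzsub : z - 1 = (a w - c w) / c w := by rw [hzdef]; field_simp
  have hN' : Valued.v (z - 1) = Valued.v (ϖ ^ N) := by rw [hzsub, Valuation.map_div, hvc, div_one, hN]
  have hz1 : z - 1 ≠ 0 := by rw [hzsub]; exact div_ne_zero hac0 hc0
  have hcore := localComponent_sub_one_eq_neg_one_pow_mul L v w hw hunr μ hμω hσδ hδ hδ0 hM₁ hM₀ hMN hz hN' hz1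
  have hcne : c ≠ 0 := fun h0 => hc0 (by rw [h0, Pi.zero_apply])
  have hacne : a - c ≠ 0 := fun h0 => hac0 (by rw [← Pi.sub_apply, h0, Pi.zero_apply])
  have hcu : IsUnit c := isUnit_localRing_of_ne_zero_of_subsingleton L v hv hcne
  have hacu : IsUnit (a - c) := isUnit_localRing_of_ne_zero_of_subsingleton L v hv hacne
  have hu1 : MulEquiv.piUnits hacu.unit w = Units.mk0 (c w) hc0 * Units.mk0 (z - 1) hz1 :=
    Units.ext (by
      rw [Units.val_mul, Units.val_mk0, Units.val_mk0, hzsub, mul_div_cancel₀ _ hc0]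
      rfl)
  have hu2 : MulEquiv.piUnits hcu.unit w = Units.mk0 (c w) hc0 := Units.ext rfl
  rw [finHeckeValue_eq_localComponent_of_nonsplit L v w hw μ hacu, finHeckeValue_eq_localComponent_of_nonsplit L v w hw μ hcu, hu1, hu2, map_mul,
    Units.val_mul, hcore, sqrt_prod_norm_eq_inv_pow L v w hw hunr (x := a - c) (N := N) (by rw [Pi.sub_apply]; exact hN)]
  push_cast
  have hneg : ((-1 : ℂ) ^ N)⁻¹ = (-1 : ℂ) ^ N := by rw [← inv_pow, inv_neg, inv_one]
  rw [mul_inv, mul_inv, hneg]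
  ring

end Letter

end Literature.NumberTheory.Rogawski1990

end
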